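import Literature.AlgebraicGeometry.Modules.TensorProduct
import Literature.AlgebraicGeometry.Motives.HodgeSheaves
import HarnessLib

/-!
# The unit isomorphisms `E ⊗_{𝒪_X} 𝒪_X ≅ E` and `𝒪_X ⊗_{𝒪_X} E ≅ E`

`Modules/TensorProduct.lean` constructs the tensor product `tensorObj M N = M ⊗_{𝒪_X} N` of
`𝒪_X`-modules on a scheme (sheafification of Mathlib's presheaf tensor product) and deliberately
leaves out the unitors ("Not here (deliberately): the associator/unitors/symmetry … and the
identification `E ⊗ 𝒪_X ≅ E`"). The identification IS needed to read the deformation-theoretic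
obstruction groups `Extⁿ(E, E ⊗ I)` (`Deformation/VectorBundleLifting.obstructionGroup`) with
coefficients `I ≅ 𝒪_X` (e.g. `I = pⁿ𝒪/pⁿ⁺¹𝒪 ≅ 𝒪_{X₁}` on a `W_n`-thickening) as `Extⁿ(E, E)`, the
source of the semiregularity map; this file supplies it:

* `tensorUnitRightIso E : E ⊗ 𝒪_X ≅ E` and `tensorUnitLeftIso E : 𝒪_X ⊗ E ≅ E` — Mathlib's unitors
  `ρ_`, `λ_` of the monoidal category of PRESHEAVES of modules (`M(U) ⊗_{𝒪(U)} 𝒪(U) ≅ M(U)`),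
  sheafified, followed by `(E^{psh})^# ≅ E` (`Motives.sheafificationValIso`, the counit of the
  sheafification adjunction) — The Stacks project, Tag 01CA: "`ℱ ⊗_{𝒪_X} 𝒪_X = ℱ`" up to the
  sheafification isomorphism;
* `extTensorUnitRightEquiv E F n : Extⁿ(F, E ⊗ 𝒪_X) ≃+ Extⁿ(F, E)` — transport of Mathlib's `Ext`
  along it (so `obstructionGroup n E 𝒪_X ≃+ Extⁿ(E, E)`).

## References

* [StacksProject] The Stacks project, Tag 01CA (Modules, §16: "`ℱ ⊗_{𝒪_X} 𝒪_X = ℱ`", functoriality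
  and the sheafification description).
-/

noncomputable section

open CategoryTheory CategoryTheory.Limits AlgebraicGeometry MonoidalCategory

universe w u

namespace Literature.AlgebraicGeometry.Modules

open Literature.AlgebraicGeometry.Motives

variable {X : Scheme.{u}}

/-- The underlying presheaf of modules of `𝒪_X` (Mathlib's `SheafOfModules.unit`) is the monoidal
unit of the category of presheaves of `𝒪_X`-modules. [folklore] -/
lemma toCommRingedPresheaf_unit :
    toCommRingedPresheaf (SheafOfModules.unit X.ringCatSheaf) = 𝟙_ (CommRingedPresheafOfModules X) :=
  rfl

/-- The right unitor `E(U) ⊗_{𝒪(U)} 𝒪(U) ≅ E(U)` of the monoidal category of presheaves of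
`𝒪_X`-modules (Mathlib), at the underlying presheaf of an `𝒪_X`-module `E`. [folklore] -/
def presheafTensorUnitRightIso (E : X.Modules) :
    (toCommRingedPresheaf E ⊗ toCommRingedPresheaf (SheafOfModules.unit X.ringCatSheaf) :
      CommRingedPresheafOfModules X) ≅ toCommRingedPresheaf E :=
  ρ_ (toCommRingedPresheaf E)

/-- The left unitor `𝒪(U) ⊗_{𝒪(U)} E(U) ≅ E(U)` of presheaves of `𝒪_X`-modules (Mathlib), at the
underlying presheaf of `E`. [folklore] -/
def presheafTensorUnitLeftIso (E : X.Modules) :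
    (toCommRingedPresheaf (SheafOfModules.unit X.ringCatSheaf) ⊗ toCommRingedPresheaf E :
      CommRingedPresheafOfModules X) ≅ toCommRingedPresheaf E :=
  λ_ (toCommRingedPresheaf E)

/-- **`E ⊗_{𝒪_X} 𝒪_X ≅ E`**: the right unitor of presheaves of modules, sheafified, followed by the
sheafification isomorphism `(E^{psh})^# ≅ E`. [cite: StacksProject, Tag 01CA] -/
def tensorUnitRightIso (E : X.Modules) : tensorObj E (SheafOfModules.unit X.ringCatSheaf) ≅ E :=
  (modulesSheafify X).mapIso (presheafTensorUnitRightIso E) ≪≫ sheafificationValIso E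

/-- **`𝒪_X ⊗_{𝒪_X} E ≅ E`**: the left unitor, sheafified. [cite: StacksProject, Tag 01CA] -/
def tensorUnitLeftIso (E : X.Modules) : tensorObj (SheafOfModules.unit X.ringCatSheaf) E ≅ E :=
  (modulesSheafify X).mapIso (presheafTensorUnitLeftIso E) ≪≫ sheafificationValIso E

/-! ### Transport of `Ext` along the unit isomorphism -/

section Ext

variable [HasExt.{w} X.Modules]

/-- Post-composition of `Ext` classes with an isomorphism `e : Y ≅ Y'`, as an additive
isomorphism `Extⁿ(F, Y) ≃+ Extⁿ(F, Y')` (inverse: post-composition with `e⁻¹`). [folklore] -/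
def extCongrRight (F : X.Modules) {Y Y' : X.Modules} (e : Y ≅ Y') (n : ℕ) :
    Abelian.Ext.{w} F Y n ≃+ Abelian.Ext.{w} F Y' n :=
  ((Abelian.Ext.mk₀ e.hom).postcomp F (add_zero n)).toAddEquiv
    ((Abelian.Ext.mk₀ e.inv).postcomp F (add_zero n))
    (by
      ext x
      change (x.comp (Abelian.Ext.mk₀ e.hom) (add_zero n)).comp (Abelian.Ext.mk₀ e.inv) (add_zero n) = x
      rw [Abelian.Ext.comp_assoc_of_third_deg_zero, Abelian.Ext.mk₀_comp_mk₀, e.hom_inv_id,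
        Abelian.Ext.comp_mk₀_id])
    (by
      ext x
      change (x.comp (Abelian.Ext.mk₀ e.inv) (add_zero n)).comp (Abelian.Ext.mk₀ e.hom) (add_zero n) = x
      rw [Abelian.Ext.comp_assoc_of_third_deg_zero, Abelian.Ext.mk₀_comp_mk₀, e.inv_hom_id,
        Abelian.Ext.comp_mk₀_id])

/-- `extCongrRight e` is post-composition with `e.hom`. [folklore] -/
@[simp]
lemma extCongrRight_apply (F : X.Modules) {Y Y' : X.Modules} (e : Y ≅ Y') (n : ℕ)
    (x : Abelian.Ext.{w} F Y n) :
    extCongrRight F e n x = x.comp (Abelian.Ext.mk₀ e.hom) (add_zero n) := rfl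

/-- **`Extⁿ(F, E ⊗ 𝒪_X) ≃+ Extⁿ(F, E)`** (transport along `tensorUnitRightIso`); for `F = E` this
reads the obstruction group `Extⁿ(E, E ⊗ 𝒪_X)` of `Deformation/VectorBundleLifting` as `Extⁿ(E, E)`,
the source of the semiregularity map. [cite: StacksProject, Tag 01CA] -/
def extTensorUnitRightEquiv (E F : X.Modules) (n : ℕ) :
    Abelian.Ext.{w} F (tensorObj E (SheafOfModules.unit X.ringCatSheaf)) n ≃+ Abelian.Ext.{w} F E n :=
  extCongrRight F (tensorUnitRightIso E) n

/-- `extTensorUnitRightEquiv` is post-composition with `tensorUnitRightIso`. [folklore] -/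
@[simp]
lemma extTensorUnitRightEquiv_apply (E F : X.Modules) (n : ℕ)
    (x : Abelian.Ext.{w} F (tensorObj E (SheafOfModules.unit X.ringCatSheaf)) n) :
    extTensorUnitRightEquiv E F n x = x.comp (Abelian.Ext.mk₀ (tensorUnitRightIso E).hom) (add_zero n) :=
  rfl

end Ext

end Literature.AlgebraicGeometry.Modules

end
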